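import Summits.BirchSwinnertonDyer.BirchSwinnertonDyer.Theorems.GenusKolyvaginAtTwoTorsionCellSELNegTwistBase
import Summits.BirchSwinnertonDyer.BirchSwinnertonDyer.Theorems.GenusKolyvaginAtTwoTorsionCellSELNegTwistSurjPrelims
import Summits.BirchSwinnertonDyer.BirchSwinnertonDyer.Theorems.GenusKolyvaginAtTwoTorsionCellSELNegTwistBridge
import Summits.BirchSwinnertonDyer.BirchSwinnertonDyer.Theorems.GenusKolyvaginAtTwoTorsionCellSELBorderedCount
import HarnessLib

/-!
# SEL (iso-class Selmer pair law), C1-O: every Selmer class of `E^{(−p₀M)}` is a parametrised class (surjectivity)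

Crux R″ `RankOneTwoTorsionResidualAtTwo` (stmt-27478), LINE 49 «full_vertex», SUPPORT stub SEL
`IsoClassSelmerPairLawAtTwo`, the `C₁` half (LEAD memo `Cruxes/…/Lines/torsion_cell_full_vertex_SEL_C1_road_g36.md`, §2–§3).
Setting of parts C1-E…C1-N, with the base pair `(w₁, w₂)` of part C1-K given by its bits.  **`exists_param_of_mem_selmerGroup`**:
for `c ∈ Sel⁽²⁾(E^{(d)}/ℚ)` with components `(a, b)` there are scalars `σ, τ₁, τ₂, γ_a, γ_b ∈ 𝔽₂`, supports
`Q_a, Q_b ⊆ Q` and a torsion pair `(t₁, t₂)` (indexed by `τ`) with `[a] = [w₁^σ t₁ (−p₀)^{γ_a} ∏_{Q_a} i]`,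
`[b] = [w₂^σ t₂ (−p₀)^{γ_b} ∏_{Q_b} i]`, and the STANDARD raw rows (constants `τ₁+ετ₂`, `(1+ε)τ₁+τ₂`, `σ`, `τ₁+τ₂`).
Proof: kernels and raw rows (C1-E/F); the parity relation `(#Q_a, #Q_b) ≡ (1+ε, ε)·sgn m_a` from the row sums; even case:
`kernel_eq_torsion_of_relaxed_even`; odd case: strip the base pair (its combined class is relaxed, C1-K) and apply the even
case to the `S`-unit remainder.

Everything is proved; no LINE 49 statement is restated; BSD is not advanced by this file alone.

## References

* [SilvermanAEC2009] J. H. Silverman, *The Arithmetic of Elliptic Curves*, 2nd ed., Prop. X.1.4, Thm. X.4.2, Prop. X.4.9.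
* [KlagsbrunMazurRubin2013] Z. Klagsbrun, B. Mazur, K. Rubin, Ann. of Math. 178 (2013), Thm. 3.9.
* [Kane2013SelmerTwists] D. M. Kane, Algebra Number Theory 7 (2013), §2.
-/

noncomputable section

open scoped Classical

namespace Summit.BirchSwinnertonDyer.BirchSwinnertonDyer.Theorems.GenusKolyvaginAtTwo.TorsionCellSEL

open WeierstrassCurve WeierstrassCurve.Affine WeierstrassCurve.Affine.Point
open Literature.NumberTheory.GaloisRepresentations Literature.NumberTheory.EllipticCurves Field
open Literature.NumberTheory.EllipticCurves.TwoDescentLocal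
open Literature.NumberTheory.EllipticCurves.KramerTwoDescent
open Literature.NumberTheory.QuadraticForms
open Summit.BirchSwinnertonDyer.BirchSwinnertonDyer.Theorems.GenusKolyvaginAtTwo.TorsionCellD0
open Summit.BirchSwinnertonDyer.BirchSwinnertonDyer.Theorems.GenusKolyvaginAtTwo.FullVertex
open IsDedekindDomain NumberField Rat.HeightOneSpectrum Matrix

variable (E : WeierstrassCurve ℚ) [E.IsElliptic] {e₁ e₂ e₃ : ℚ} (S Q : Finset ℕ) {p₀ : ℕ} [hp₀ : Fact p₀.Prime]

/-! ## Surjectivity of the parametrisation -/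

/-- **EVERY SELMER CLASS OF `E^{(−p₀M)}` IS PARAMETRISED** (see the module docstring).
[cite: SilvermanAEC2009, Prop. X.1.4, Thm. X.4.2, Prop. X.4.9] [cite: KlagsbrunMazurRubin2013, Thm. 3.9]
[cite: Kane2013SelmerTwists, §2] -/
theorem exists_param_of_mem_selmerGroup (h : E.toAffine.SplitTwoTorsion e₁ e₂ e₃) (h12 : e₁ < e₂) (h23 : e₂ < e₃)
    (hS : ∀ ℓ ∈ S, ℓ.Prime) (h2S : 2 ∈ S)
    (hgood : ∀ ℓ : ℕ, (hℓ : ℓ.Prime) → ℓ ∉ S → haveI : Fact ℓ.Prime := ⟨hℓ⟩;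
      padicValRat ℓ (e₁ - e₂) = 0 ∧ padicValRat ℓ (e₁ - e₃) = 0 ∧ padicValRat ℓ (e₂ - e₃) = 0)
    (hN : ∀ ℓ : ℕ, ℓ.Prime → ℓ ∉ S → ¬ ℓ ∣ E.conductorNorm ℤ)
    (hrank : E.mordellWeilRank = 0) (hsha : ∀ x ∈ E.sha, (2 : ℕ) • x = 0 → x = 0)
    (hQ : ∀ q ∈ Q, q.Prime) (hQS : ∀ q ∈ Q, q ∉ S) (hQ4 : ∀ q ∈ Q, q % 4 = 3) (hk : Even Q.card)
    {q₀ : ℕ} (hq₀ : q₀ ∈ Q)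
    (hiso8 : ∀ q ∈ Q, ∀ q' ∈ Q, q % 8 = q' % 8)
    (hisoS : ∀ q ∈ Q, ∀ q' ∈ Q, ∀ ℓ ∈ S, (hℓ : ℓ.Prime) → ℓ ≠ 2 → haveI : Fact ℓ.Prime := ⟨hℓ⟩;
      legendreSym ℓ ((q : ℤ) * q') = 1)
    (hadm : ∀ q ∈ Q, (hq : q.Prime) → haveI : Fact q.Prime := ⟨hq⟩;
      qrBit q ((e₁ - e₂) * (e₁ - e₃)) = 1 ∧ qrBit q ((e₂ - e₁) * (e₂ - e₃)) = 1)
    {ε : ZMod 2} (hε : ∀ q ∈ Q, (hq : q.Prime) → haveI : Fact q.Prime := ⟨hq⟩; qrBit q (e₂ - e₁) = ε)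
    (hp₀S : p₀ ∉ S) (hp₀Q : p₀ ∉ Q) (hp8 : p₀ % 8 = 7)
    (hsplitp : ∀ ℓ ∈ S, (hℓ : ℓ.Prime) → ℓ ≠ 2 → haveI : Fact ℓ.Prime := ⟨hℓ⟩; legendreSym ℓ (-(p₀ : ℤ)) = 1)
    (hres₀ : qrBit p₀ (e₂ - e₁) = 0 ∧ qrBit p₀ (e₃ - e₁) = 0 ∧ qrBit p₀ (e₃ - e₂) = 0)
    (w₁ w₂ : ℚˣ)
    (hwpar : ∀ ℓ : ℕ, (hℓ : ℓ.Prime) → ℓ ∉ S → haveI : Fact ℓ.Prime := ⟨hℓ⟩; parityBit ℓ (w₁ : ℚ) = 0 ∧ parityBit ℓ (w₂ : ℚ) = 0)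
    (hwres : ∀ j ∈ Q, (hj : j.Prime) → haveI : Fact j.Prime := ⟨hj⟩; qrBit j (w₁ : ℚ) = 0 ∧ qrBit j (w₂ : ℚ) = 0)
    (hws : signBit (w₁ : ℚ) = 1 ∧ signBit (w₂ : ℚ) = 0)
    (hwrel : ∀ (A₁ A₂ : Finset ℕ), A₁ ⊆ Q → A₂ ⊆ Q → (A₁.card : ZMod 2) = 1 + ε → (A₂.card : ZMod 2) = ε →
      ∀ (hp₁ : ∏ i ∈ A₁, (i : ℚ) ≠ 0) (hp₂ : ∏ i ∈ A₂, (i : ℚ) ≠ 0),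
      ∀ v : HeightOneSpectrum (𝓞 ℚ), natGenerator v ∈ S →
        E.twoDescentClass h (w₁ * Units.mk0 _ hp₁) (w₂ * Units.mk0 _ hp₂) ∈ selmerLocalKer E (v.adicCompletion ℚ) 2)
    {d : ℚ} (hd : d = -(p₀ : ℚ) * ∏ q ∈ Q, (q : ℚ)) [(E.quadraticTwist d).IsElliptic]
    {c : galH1Torsion (E.quadraticTwist d) 2} (hc : c ∈ selmerGroup (E.quadraticTwist d) 2) (a b : ℚˣ)
    (ha : kummerEquiv ℚ 2 ((E.quadraticTwist d).twoTorsionCharH1 (h.quadraticTwist d) c) = Additive.ofMul (QuotientGroup.mk a))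
    (hb : kummerEquiv ℚ 2 ((E.quadraticTwist d).twoTorsionCharH1 (h.quadraticTwist d).swap₁₂ c) =
      Additive.ofMul (QuotientGroup.mk b)) :
    ∃ (σ τ₁ τ₂ γa γb : ZMod 2) (Qa Qb : Finset ℕ) (t₁ t₂ : ℚˣ), Qa ⊆ Q ∧ Qb ⊆ Q ∧
      ((τ₁ = 0 ∧ τ₂ = 0 ∧ (t₁ : ℚ) = 1 ∧ (t₂ : ℚ) = 1) ∨
        (τ₁ = 1 ∧ τ₂ = 0 ∧ (t₁ : ℚ) = (e₁ - e₂) * (e₁ - e₃) ∧ (t₂ : ℚ) = e₁ - e₂) ∨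
        (τ₁ = 0 ∧ τ₂ = 1 ∧ (t₁ : ℚ) = e₂ - e₁ ∧ (t₂ : ℚ) = (e₂ - e₁) * (e₂ - e₃)) ∨
        (τ₁ = 1 ∧ τ₂ = 1 ∧ (t₁ : ℚ) = e₃ - e₁ ∧ (t₂ : ℚ) = e₃ - e₂)) ∧
      (∃ (hpa : ∏ i ∈ Qa, (i : ℚ) ≠ 0) (hpb : ∏ i ∈ Qb, (i : ℚ) ≠ 0) (Xa Xb : ℚˣ),
        ((γa = 0 ∧ (Xa : ℚ) = 1) ∨ (γa = 1 ∧ (Xa : ℚ) = -(p₀ : ℚ))) ∧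
        ((γb = 0 ∧ (Xb : ℚ) = 1) ∨ (γb = 1 ∧ (Xb : ℚ) = -(p₀ : ℚ))) ∧
        (QuotientGroup.mk a : SqUnits ℚ) =
          QuotientGroup.mk (((if σ = 1 then w₁ else 1) * Units.mk0 _ hpa) * (t₁ * Xa)) ∧
        (QuotientGroup.mk b : SqUnits ℚ) =
          QuotientGroup.mk (((if σ = 1 then w₂ else 1) * Units.mk0 _ hpb) * (t₂ * Xb))) ∧
      (∀ j ∈ Q,
        ((∑ i ∈ Q.erase j, (if jacobiSym (-(i : ℤ)) j = -1 then (1 : ZMod 2) else 0) * (if i ∈ Qa then 1 else 0)) +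
            ((∑ i ∈ Q.erase j, (if jacobiSym (-(i : ℤ)) j = -1 then (1 : ZMod 2) else 0)) +
              (if jacobiSym (-(p₀ : ℤ)) j = -1 then (1 : ZMod 2) else 0) + ε) * (if j ∈ Qa then 1 else 0) +
            (if j ∈ Qb then 1 else 0) =
          (τ₁ + ε * τ₂) + γa * (if jacobiSym (-(p₀ : ℤ)) j = -1 then (1 : ZMod 2) else 0) + (Qa.card : ZMod 2)) ∧
        ((∑ i ∈ Q.erase j, (if jacobiSym (-(i : ℤ)) j = -1 then (1 : ZMod 2) else 0) * (if i ∈ Qb then 1 else 0)) +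
            ((∑ i ∈ Q.erase j, (if jacobiSym (-(i : ℤ)) j = -1 then (1 : ZMod 2) else 0)) +
              (if jacobiSym (-(p₀ : ℤ)) j = -1 then (1 : ZMod 2) else 0) + ε + 1) * (if j ∈ Qb then 1 else 0) +
            (if j ∈ Qa then 1 else 0) =
          ((1 + ε) * τ₁ + τ₂) + γb * (if jacobiSym (-(p₀ : ℤ)) j = -1 then (1 : ZMod 2) else 0) + (Qb.card : ZMod 2))) ∧
      (σ + ∑ i ∈ Q, (if jacobiSym (-(p₀ : ℤ)) i = -1 then (1 : ZMod 2) else 0) * (if i ∈ Qa then 1 else 0) +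
          γa * ∑ i ∈ Q, (if jacobiSym (-(p₀ : ℤ)) i = -1 then (1 : ZMod 2) else 0) = 0) ∧
      ((τ₁ + τ₂) + γb + ∑ i ∈ Q, (if jacobiSym (-(p₀ : ℤ)) i = -1 then (1 : ZMod 2) else 0) * (if i ∈ Qb then 1 else 0) +
          γa + γb * ∑ i ∈ Q, (if jacobiSym (-(p₀ : ℤ)) i = -1 then (1 : ZMod 2) else 0) = 0) ∧
      (σ + γa = (τ₁ + τ₂) + γb) := by
  haveI hq₀F : Fact q₀.Prime := ⟨hQ q₀ hq₀⟩
  have hp4 : p₀ % 4 = 3 := by omega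
  have hq₀4 : q₀ % 4 = 3 := hQ4 q₀ hq₀
  have hQ0 : ∀ q ∈ Q, (q : ℚ) ≠ 0 := fun q hq => by exact_mod_cast (hQ q hq).ne_zero
  have hp0 : (p₀ : ℚ) ≠ 0 := by exact_mod_cast hp₀.out.ne_zero
  have he12 : e₁ - e₂ ≠ 0 := sub_ne_zero.mpr h.ne₁₂
  have he21 : e₂ - e₁ ≠ 0 := sub_ne_zero.mpr h.ne₁₂.symm
  have he13 : e₁ - e₃ ≠ 0 := sub_ne_zero.mpr h.ne₁₃
  have he31 : e₃ - e₁ ≠ 0 := sub_ne_zero.mpr h.ne₁₃.symm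
  have he23 : e₂ - e₃ ≠ 0 := sub_ne_zero.mpr h.ne₂₃
  have he32 : e₃ - e₂ ≠ 0 := sub_ne_zero.mpr h.ne₂₃.symm
  -- residues of the root data at `p₀` in the four-fact form
  obtain ⟨r21, r31, r32⟩ := hres₀
  have hm1p : qrBit p₀ (-1 : ℚ) = 1 := qrBit_neg_one_eq_one_of_emod_four hp4
  have r12 : qrBit p₀ (e₁ - e₂) = 1 := by rw [← neg_sub, qrBit_neg (p := p₀) he21, hm1p, r21, add_zero]
  have r13 : qrBit p₀ (e₁ - e₃) = 1 := by rw [← neg_sub, qrBit_neg (p := p₀) he31, hm1p, r31, add_zero]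
  have r23 : qrBit p₀ (e₂ - e₃) = 1 := by rw [← neg_sub, qrBit_neg (p := p₀) he32, hm1p, r32, add_zero]
  have hres₀4 : qrBit p₀ (e₂ - e₁) = 0 ∧ qrBit p₀ (e₁ - e₂) = 1 ∧
      qrBit p₀ ((e₁ - e₂) * (e₁ - e₃)) = 0 ∧ qrBit p₀ ((e₂ - e₁) * (e₂ - e₃)) = 1 :=
    ⟨r21, r12, by rw [qrBit_mul p₀ he12 he13, r12, r13]; decide, by rw [qrBit_mul p₀ he21 he23, r21, r23, zero_add]⟩
  -- kernels and raw rows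
  obtain ⟨ma, mb, γa, γb, ⟨hma0, hmadiv, hγa, ⟨hga, hcla⟩, hηa⟩, ⟨hmb0, hmbdiv, hγb, ⟨hgb, hclb⟩, hηb⟩, hrows, hPa, hPb,
    hinf⟩ := rows_of_mem_selmerGroup_negTwist E S Q h h12 h23 hS hgood hQ hQS hQ4 hk hiso8 hisoS hadm hε hp₀S hp₀Q hp4
      hres₀4 hd hc a b ha hb
  -- the supports and their indicators
  set Qa : Finset ℕ := Q.filter (fun i => parityBit i (a : ℚ) = 1) with hQadef
  set Qb : Finset ℕ := Q.filter (fun i => parityBit i (b : ℚ) = 1) with hQbdef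
  have hQaQ : Qa ⊆ Q := Finset.filter_subset _ _
  have hQbQ : Qb ⊆ Q := Finset.filter_subset _ _
  have hpa0 : ∏ i ∈ Qa, (i : ℚ) ≠ 0 := Finset.prod_ne_zero_iff.mpr fun i hi => hQ0 i (hQaQ hi)
  have hpb0 : ∏ i ∈ Qb, (i : ℚ) ≠ 0 := Finset.prod_ne_zero_iff.mpr fun i hi => hQ0 i (hQbQ hi)
  have hz2 : ∀ x : ZMod 2, x = 0 ∨ x = 1 := by decide
  have hindA : ∀ i ∈ Q, parityBit i (a : ℚ) = (if i ∈ Qa then 1 else 0) := by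
    intro i hi
    by_cases hiA : i ∈ Qa
    · rw [if_pos hiA]; exact (Finset.mem_filter.mp hiA).2
    · rw [if_neg hiA]
      rcases hz2 (parityBit i (a : ℚ)) with h0 | h1
      · exact h0
      · exact absurd (Finset.mem_filter.mpr ⟨hi, h1⟩) hiA
  have hindB : ∀ i ∈ Q, parityBit i (b : ℚ) = (if i ∈ Qb then 1 else 0) := by
    intro i hi
    by_cases hiB : i ∈ Qb
    · rw [if_pos hiB]; exact (Finset.mem_filter.mp hiB).2
    · rw [if_neg hiB]
      rcases hz2 (parityBit i (b : ℚ)) with h0 | h1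
      · exact h0
      · exact absurd (Finset.mem_filter.mpr ⟨hi, h1⟩) hiB
  have hcardA : ∑ i ∈ Q, parityBit i (a : ℚ) = (Qa.card : ZMod 2) := by
    rw [Finset.sum_congr rfl hindA, Finset.sum_boole, Finset.filter_mem_eq_inter, Finset.inter_eq_right.mpr hQaQ]
  have hcardB : ∑ i ∈ Q, parityBit i (b : ℚ) = (Qb.card : ZMod 2) := by
    rw [Finset.sum_congr rfl hindB, Finset.sum_boole, Finset.filter_mem_eq_inter, Finset.inter_eq_right.mpr hQbQ]
  -- the constants of the `S`-kernels
  set c₁ := qrBit q₀ (ma : ℚ) with hc₁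
  set c₂ := qrBit q₀ (mb : ℚ) with hc₂
  have hparma : ∀ ℓ : ℕ, (hℓ : ℓ.Prime) → ℓ ∉ S → haveI : Fact ℓ.Prime := ⟨hℓ⟩;
      parityBit ℓ ((Units.mk0 (ma : ℚ) hma0 : ℚˣ) : ℚ) = 0 := by
    intro ℓ hℓ hℓS; haveI : Fact ℓ.Prime := ⟨hℓ⟩
    rw [Units.val_mk0, parityBit, padicValRat.of_int, padicValInt.eq_zero_of_not_dvd (hmadiv ℓ hℓ hℓS)]; rfl
  have hparmb : ∀ ℓ : ℕ, (hℓ : ℓ.Prime) → ℓ ∉ S → haveI : Fact ℓ.Prime := ⟨hℓ⟩;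
      parityBit ℓ ((Units.mk0 (mb : ℚ) hmb0 : ℚˣ) : ℚ) = 0 := by
    intro ℓ hℓ hℓS; haveI : Fact ℓ.Prime := ⟨hℓ⟩
    rw [Units.val_mk0, parityBit, padicValRat.of_int, padicValInt.eq_zero_of_not_dvd (hmbdiv ℓ hℓ hℓS)]; rfl
  have hρa : qrBit p₀ (ma : ℚ) = signBit (ma : ℚ) := by
    have := qrBit_p₀_eq_signBit S hS hp₀S hp8 hsplitp (Units.mk0 (ma : ℚ) hma0) hparma
    rwa [Units.val_mk0] at this
  have hρb : qrBit p₀ (mb : ℚ) = signBit (mb : ℚ) := by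
    have := qrBit_p₀_eq_signBit S hS hp₀S hp8 hsplitp (Units.mk0 (mb : ℚ) hmb0) hparmb
    rwa [Units.val_mk0] at this
  -- the raw rows in indicator form
  have hrowsI : ∀ j ∈ Q,
      ((∑ i ∈ Q.erase j, (if jacobiSym (-(i : ℤ)) j = -1 then (1 : ZMod 2) else 0) * (if i ∈ Qa then 1 else 0)) +
          ((∑ i ∈ Q.erase j, (if jacobiSym (-(i : ℤ)) j = -1 then (1 : ZMod 2) else 0)) +
            (if jacobiSym (-(p₀ : ℤ)) j = -1 then (1 : ZMod 2) else 0) + ε) * (if j ∈ Qa then 1 else 0) +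
          (if j ∈ Qb then 1 else 0) =
        c₁ + γa * (if jacobiSym (-(p₀ : ℤ)) j = -1 then (1 : ZMod 2) else 0) + (Qa.card : ZMod 2)) ∧
      ((∑ i ∈ Q.erase j, (if jacobiSym (-(i : ℤ)) j = -1 then (1 : ZMod 2) else 0) * (if i ∈ Qb then 1 else 0)) +
          ((∑ i ∈ Q.erase j, (if jacobiSym (-(i : ℤ)) j = -1 then (1 : ZMod 2) else 0)) +
            (if jacobiSym (-(p₀ : ℤ)) j = -1 then (1 : ZMod 2) else 0) + ε + 1) * (if j ∈ Qb then 1 else 0) +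
          (if j ∈ Qa then 1 else 0) =
        c₂ + γb * (if jacobiSym (-(p₀ : ℤ)) j = -1 then (1 : ZMod 2) else 0) + (Qb.card : ZMod 2)) := by
    intro j hj
    have hjp := hQ j hj
    obtain ⟨r1, r2⟩ := hrows j hj hjp
    have e1 : (∑ i ∈ Q.erase j, (if jacobiSym (-(i : ℤ)) j = -1 then (1 : ZMod 2) else 0) * parityBit i (a : ℚ)) =
        ∑ i ∈ Q.erase j, (if jacobiSym (-(i : ℤ)) j = -1 then (1 : ZMod 2) else 0) * (if i ∈ Qa then 1 else 0) :=
      Finset.sum_congr rfl fun i hi => by rw [hindA i (Finset.mem_of_mem_erase hi)]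
    have e2 : (∑ i ∈ Q.erase j, (if jacobiSym (-(i : ℤ)) j = -1 then (1 : ZMod 2) else 0) * parityBit i (b : ℚ)) =
        ∑ i ∈ Q.erase j, (if jacobiSym (-(i : ℤ)) j = -1 then (1 : ZMod 2) else 0) * (if i ∈ Qb then 1 else 0) :=
      Finset.sum_congr rfl fun i hi => by rw [hindB i (Finset.mem_of_mem_erase hi)]
    haveI : Fact j.Prime := ⟨hjp⟩
    rw [e1, hindA j hj, hindB j hj, hcardA, hηa j hj q₀ hq₀ hjp hq₀F.out] at r1
    rw [e2, hindA j hj, hindB j hj, hcardB, hηb j hj q₀ hq₀ hjp hq₀F.out] at r2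
    exact ⟨r1, r2⟩
  have hPaI : qrBit p₀ (ma : ℚ) + ∑ i ∈ Q, (if jacobiSym (-(p₀ : ℤ)) i = -1 then (1 : ZMod 2) else 0) * (if i ∈ Qa then 1 else 0) +
      γa * ∑ i ∈ Q, (if jacobiSym (-(p₀ : ℤ)) i = -1 then (1 : ZMod 2) else 0) = 0 := by
    have e : ∑ i ∈ Q, (if jacobiSym (-(p₀ : ℤ)) i = -1 then (1 : ZMod 2) else 0) * (if i ∈ Qa then 1 else 0) =
        ∑ i ∈ Q, (if jacobiSym (-(p₀ : ℤ)) i = -1 then (1 : ZMod 2) else 0) * parityBit i (a : ℚ) :=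
      Finset.sum_congr rfl fun i hi => by rw [hindA i hi]
    rw [e]; exact hPa
  have hPbI : qrBit p₀ (mb : ℚ) + γb + ∑ i ∈ Q, (if jacobiSym (-(p₀ : ℤ)) i = -1 then (1 : ZMod 2) else 0) * (if i ∈ Qb then 1 else 0) +
      γa + γb * ∑ i ∈ Q, (if jacobiSym (-(p₀ : ℤ)) i = -1 then (1 : ZMod 2) else 0) = 0 := by
    have e : ∑ i ∈ Q, (if jacobiSym (-(p₀ : ℤ)) i = -1 then (1 : ZMod 2) else 0) * (if i ∈ Qb then 1 else 0) =
        ∑ i ∈ Q, (if jacobiSym (-(p₀ : ℤ)) i = -1 then (1 : ZMod 2) else 0) * parityBit i (b : ℚ) :=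
      Finset.sum_congr rfl fun i hi => by rw [hindB i hi]
    rw [e]; exact hPb
  -- PARITIES of the supports from the row sums
  have hQaM : ∀ j : Q, (borderedLaplacian Q p₀ *ᵥ (fun i : Q => if (i : ℕ) ∈ Qa then (1 : ZMod 2) else 0)) j +
      ε * (if (j : ℕ) ∈ Qa then (1 : ZMod 2) else 0) + (if (j : ℕ) ∈ Qb then (1 : ZMod 2) else 0) =
        γa * legendreBit (-(p₀ : ℤ)) (j : ℕ) + (c₁ + ε * 0 + ∑ i : Q, (if (i : ℕ) ∈ Qa then (1 : ZMod 2) else 0)) := by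
    intro j
    rw [mulVec_borderedLaplacian_indicator, sum_indicator_eq_card Q hQaQ, legendreBit_eq_ite]
    linear_combination (hrowsI j j.2).1
  have hQbM : ∀ j : Q, (borderedLaplacian Q p₀ *ᵥ (fun i : Q => if (i : ℕ) ∈ Qb then (1 : ZMod 2) else 0)) j +
      (ε + 1) * (if (j : ℕ) ∈ Qb then (1 : ZMod 2) else 0) + (if (j : ℕ) ∈ Qa then (1 : ZMod 2) else 0) =
        γb * legendreBit (-(p₀ : ℤ)) (j : ℕ) + ((ε + 1) * 0 + c₂ + ∑ i : Q, (if (i : ℕ) ∈ Qb then (1 : ZMod 2) else 0)) := by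
    intro j
    rw [mulVec_borderedLaplacian_indicator, sum_indicator_eq_card Q hQbQ, legendreBit_eq_ite]
    linear_combination (hrowsI j j.2).2
  have rsA := rowsum_Qa Q p₀ hQ hQ4 hk hQaM
  have rsB := rowsum_Qb Q p₀ hQ hQ4 hk hQbM
  rw [sum_indicator_eq_card Q hQaQ, sum_indicator_eq_card Q hQbQ,
    sum_mul_indicator_eq Q (fun i => legendreBit (-(p₀ : ℤ)) i) Qa,
    Finset.sum_coe_sort Q (fun i => legendreBit (-(p₀ : ℤ)) i)] at rsA
  rw [sum_indicator_eq_card Q hQaQ, sum_indicator_eq_card Q hQbQ,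
    sum_mul_indicator_eq Q (fun i => legendreBit (-(p₀ : ℤ)) i) Qb,
    Finset.sum_coe_sort Q (fun i => legendreBit (-(p₀ : ℤ)) i)] at rsB
  simp only [legendreBit_eq_ite] at rsA rsB
  rw [hρa] at hPaI
  rw [hρb] at hPbI
  obtain ⟨hcardQa, hcardQb⟩ := zmod2_par_supports ε (signBit (ma : ℚ)) (Qa.card : ZMod 2) (Qb.card : ZMod 2)
    (by linear_combination (norm := (ring_nf; reduce_mod_char)) rsA + hPaI)
    (by linear_combination (norm := (ring_nf; reduce_mod_char)) rsB + hPbI + hinf)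
  -- relaxedness of the kernel representatives (the frame)
  have hrelc := frame_of_mem_selmerGroup_negTwist E S Q h hQ hQS hQ4 hk hiso8 hisoS hp₀S hp8 hsplitp hd hc a b ha hb
  have hrelk : ∀ v : HeightOneSpectrum (𝓞 ℚ), natGenerator v ∈ S →
      E.twoDescentClass h (Units.mk0 _ hga) (Units.mk0 _ hgb) ∈ selmerLocalKer E (v.adicCompletion ℚ) 2 := by
    intro v hvS
    rw [← twoDescentClass_eq_of_mk_eq E h hcla hclb]; exact hrelc v hvS
  -- the twisting factors
  obtain ⟨Xa, hXaval, -, -, -, -, -⟩ := exists_twistUnit Q hp₀Q hp4 γa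
  obtain ⟨Xb, hXbval, -, -, -, -, -⟩ := exists_twistUnit Q hp₀Q hp4 γb
  have hXa_eq : (Xa : ℚ) = (if γa = 1 then -(p₀ : ℚ) else 1) := by
    rcases hXaval with ⟨h0, e⟩ | ⟨h1, e⟩
    · rw [e, h0, if_neg zero_ne_one]
    · rw [e, h1, if_pos rfl]
  have hXb_eq : (Xb : ℚ) = (if γb = 1 then -(p₀ : ℚ) else 1) := by
    rcases hXbval with ⟨h0, e⟩ | ⟨h1, e⟩
    · rw [e, h0, if_neg zero_ne_one]
    · rw [e, h1, if_pos rfl]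
  -- torsion data indexed by `τ` from a value disjunction
  have hτdata := torsionData_of_values E S Q h h12 h23 hgood hQ4 hadm hε hp4 ⟨r21, r31, r32⟩
  -- the kernel representatives as products of units
  have hKa : (Units.mk0 _ hga : ℚˣ) = Units.mk0 (ma : ℚ) hma0 * (Units.mk0 _ hpa0 * Xa) :=
    Units.ext (by simp only [Units.val_mul, Units.val_mk0, hXa_eq]; ring)
  have hKb : (Units.mk0 _ hgb : ℚˣ) = Units.mk0 (mb : ℚ) hmb0 * (Units.mk0 _ hpb0 * Xb) :=
    Units.ext (by simp only [Units.val_mul, Units.val_mk0, hXb_eq]; ring)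
  -- CASE SPLIT on the sign of `m_a`
  rcases hz2 (signBit (ma : ℚ)) with hs0 | hs1
  · ----------------------------------------------------------------- EVEN case
    rw [hs0, mul_zero] at hcardQa hcardQb
    rw [hs0] at hPaI hinf
    have hevA : Even Qa.card := (ZMod.natCast_eq_zero_iff_even).mp hcardQa
    have hevB : Even Qb.card := (ZMod.natCast_eq_zero_iff_even).mp hcardQb
    have hXa' : (if γa = 1 then -(p₀ : ℚ) else 1) = 1 ∨ (if γa = 1 then -(p₀ : ℚ) else 1) = -(p₀ : ℚ) := by
      by_cases hg : γa = 1
      · rw [if_pos hg]; exact Or.inr rfl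
      · rw [if_neg hg]; exact Or.inl rfl
    have hXb' : (if γb = 1 then -(p₀ : ℚ) else 1) = 1 ∨ (if γb = 1 then -(p₀ : ℚ) else 1) = -(p₀ : ℚ) := by
      by_cases hg : γb = 1
      · rw [if_pos hg]; exact Or.inr rfl
      · rw [if_neg hg]; exact Or.inl rfl
    obtain ⟨t₁, t₂, htv, hm₁, hm₂⟩ := kernel_eq_torsion_of_relaxed_even E S Q h h12 h23 h2S hgood hN hrank hsha hQ hQS hQ4 hq₀
      hiso8 hisoS hadm hε hp₀S hp8 hsplitp hma0 hmb0 hmadiv hmbdiv hXa' hXb' hQaQ hQbQ hevA hevB hga hgb hrelk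
    obtain ⟨τ₁, τ₂, hτv, hτQ, hτp1, hτp2, hτs1, hτs2⟩ := hτdata t₁ t₂ htv
    have hc₁v : c₁ = τ₁ + ε * τ₂ := by
      rw [hc₁, ← (hτQ q₀ hq₀ hq₀F.out).1, ← Units.val_mk0 hma0]; exact qrBit_eq_of_mk_eq q₀ hm₁
    have hc₂v : c₂ = (1 + ε) * τ₁ + τ₂ := by
      rw [hc₂, ← (hτQ q₀ hq₀ hq₀F.out).2, ← Units.val_mk0 hmb0]; exact qrBit_eq_of_mk_eq q₀ hm₂
    have hsb : signBit (mb : ℚ) = τ₁ + τ₂ := by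
      rw [← hτs2, ← Units.val_mk0 hmb0]; exact signBit_eq_of_mk_eq hm₂
    rw [hsb] at hPbI hinf
    refine ⟨0, τ₁, τ₂, γa, γb, Qa, Qb, t₁, t₂, hQaQ, hQbQ, hτv, ⟨hpa0, hpb0, Xa, Xb, hXaval, hXbval, ?_, ?_⟩,
      fun j hj => ?_, hPaI, hPbI, hinf⟩
    · rw [if_neg zero_ne_one, one_mul, hcla, hKa, QuotientGroup.mk_mul, hm₁, ← QuotientGroup.mk_mul, mul_left_comm]
    · rw [if_neg zero_ne_one, one_mul, hclb, hKb, QuotientGroup.mk_mul, hm₂, ← QuotientGroup.mk_mul, mul_left_comm]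
    · obtain ⟨r1, r2⟩ := hrowsI j hj
      rw [hc₁v] at r1
      rw [hc₂v] at r2
      exact ⟨r1, r2⟩
  · ----------------------------------------------------------------- ODD case
    rw [hs1, mul_one] at hcardQa hcardQb
    rw [hs1] at hPaI hinf
    -- the base-pair class over `(Qa, Qb)` is relaxed
    have hg := hwrel Qa Qb hQaQ hQbQ hcardQa hcardQb hpa0 hpb0
    -- the `S`-unit remainder `(m_a w₁, m_b w₂)` is relaxed
    have hsqX : ∀ {X : ℚˣ}, ((X : ℚ) = 1 ∨ (X : ℚ) = -(p₀ : ℚ)) → ∀ v : HeightOneSpectrum (𝓞 ℚ), natGenerator v ∈ S →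
        IsSquare (algebraMap ℚ (v.adicCompletion ℚ) (X : ℚ)) := by
      intro X hX v hvS
      rcases hX with e | e
      · rw [e, map_one]; exact IsSquare.one
      · rw [e]
        by_cases hv2 : (primesEquiv v : ℕ) = 2
        · exact isSquare_neg_prime_adicCompletion_two (p := p₀) hp8 v hv2
        · haveI : Fact (primesEquiv v : ℕ).Prime := ⟨(primesEquiv v).2⟩
          have hℓp : (primesEquiv v : ℕ) ≠ p₀ := fun e' => hp₀S (e' ▸ hvS)
          exact isSquare_neg_prime_adicCompletion_odd (p := p₀) v rfl hv2 hℓp (hsplitp _ hvS (primesEquiv v).2 hv2)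
    have hXav : (Xa : ℚ) = 1 ∨ (Xa : ℚ) = -(p₀ : ℚ) := by
      rcases hXaval with ⟨-, e⟩ | ⟨-, e⟩
      exacts [Or.inl e, Or.inr e]
    have hXbv : (Xb : ℚ) = 1 ∨ (Xb : ℚ) = -(p₀ : ℚ) := by
      rcases hXbval with ⟨-, e⟩ | ⟨-, e⟩
      exacts [Or.inl e, Or.inr e]
    have sq_cancel : ∀ m X P w : SqUnits ℚ, m * (P * X) * (w * P) * X = m * w := by
      intro m X P w
      calc m * (P * X) * (w * P) * X = m * w * (P * P) * (X * X) := by ac_rfl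
        _ = m * w := by rw [SqUnits.mul_self, SqUnits.mul_self, mul_one, mul_one]
    have hmk_ua : (QuotientGroup.mk (Units.mk0 (ma : ℚ) hma0 * w₁) : SqUnits ℚ) =
        QuotientGroup.mk ((Units.mk0 _ hga * (w₁ * Units.mk0 _ hpa0)) * Xa) := by
      rw [hKa]; simp only [QuotientGroup.mk_mul]; exact (sq_cancel _ _ _ _).symm
    have hmk_ub : (QuotientGroup.mk (Units.mk0 (mb : ℚ) hmb0 * w₂) : SqUnits ℚ) =
        QuotientGroup.mk ((Units.mk0 _ hgb * (w₂ * Units.mk0 _ hpb0)) * Xb) := by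
      rw [hKb]; simp only [QuotientGroup.mk_mul]; exact (sq_cancel _ _ _ _).symm
    have hrel_u : ∀ v : HeightOneSpectrum (𝓞 ℚ), natGenerator v ∈ S →
        E.twoDescentClass h (Units.mk0 (ma : ℚ) hma0 * w₁) (Units.mk0 (mb : ℚ) hmb0 * w₂) ∈
          selmerLocalKer E (v.adicCompletion ℚ) 2 := by
      intro v hvS
      rw [twoDescentClass_eq_of_mk_eq E h hmk_ua hmk_ub, twoDescentClass_mul, twoDescentClass_mul]
      exact add_mem (add_mem (hrelk v hvS) (hg v hvS)) (twoDescentClass_mem_selmerLocalKer_of_isSquare E h _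
        (charZero_of_injective_algebraMap (algebraMap ℚ _).injective) _ _ (hsqX hXav v hvS) (hsqX hXbv v hvS))
    -- integer kernels of the remainder
    have hua_par : ∀ ℓ : ℕ, (hℓ : ℓ.Prime) → ℓ ∉ S → haveI : Fact ℓ.Prime := ⟨hℓ⟩;
        parityBit ℓ ((Units.mk0 (ma : ℚ) hma0 * w₁ : ℚˣ) : ℚ) = 0 := by
      intro ℓ hℓ hℓS; haveI : Fact ℓ.Prime := ⟨hℓ⟩
      rw [Units.val_mul, parityBit_mul (Units.mk0 (ma : ℚ) hma0).ne_zero w₁.ne_zero, hparma ℓ hℓ hℓS,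
        (hwpar ℓ hℓ hℓS).1, add_zero]
    have hub_par : ∀ ℓ : ℕ, (hℓ : ℓ.Prime) → ℓ ∉ S → haveI : Fact ℓ.Prime := ⟨hℓ⟩;
        parityBit ℓ ((Units.mk0 (mb : ℚ) hmb0 * w₂ : ℚˣ) : ℚ) = 0 := by
      intro ℓ hℓ hℓS; haveI : Fact ℓ.Prime := ⟨hℓ⟩
      rw [Units.val_mul, parityBit_mul (Units.mk0 (mb : ℚ) hmb0).ne_zero w₂.ne_zero, hparmb ℓ hℓ hℓS,
        (hwpar ℓ hℓ hℓS).2, add_zero]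
    obtain ⟨n₁, hn₁0, hn₁div, hn₁mk⟩ := exists_int_kernel S hS _ hua_par
    obtain ⟨n₂, hn₂0, hn₂div, hn₂mk⟩ := exists_int_kernel S hS _ hub_par
    have hA0 : (n₁ : ℚ) * 1 * ∏ i ∈ (∅ : Finset ℕ), (i : ℚ) ≠ 0 := by simpa using hn₁0
    have hB0 : (n₂ : ℚ) * 1 * ∏ i ∈ (∅ : Finset ℕ), (i : ℚ) ≠ 0 := by simpa using hn₂0
    have hKn₁ : (QuotientGroup.mk (Units.mk0 _ hA0) : SqUnits ℚ) = QuotientGroup.mk (Units.mk0 (ma : ℚ) hma0 * w₁) := by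
      rw [hn₁mk]; congr 1; exact Units.ext (by simp)
    have hKn₂ : (QuotientGroup.mk (Units.mk0 _ hB0) : SqUnits ℚ) = QuotientGroup.mk (Units.mk0 (mb : ℚ) hmb0 * w₂) := by
      rw [hn₂mk]; congr 1; exact Units.ext (by simp)
    have hloc_n : ∀ v : HeightOneSpectrum (𝓞 ℚ), natGenerator v ∈ S →
        E.twoDescentClass h (Units.mk0 _ hA0) (Units.mk0 _ hB0) ∈ selmerLocalKer E (v.adicCompletion ℚ) 2 := by
      intro v hvS
      rw [twoDescentClass_eq_of_mk_eq E h hKn₁ hKn₂]; exact hrel_u v hvS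
    obtain ⟨t₁, t₂, htv, hm₁, hm₂⟩ := kernel_eq_torsion_of_relaxed_even E S Q h h12 h23 h2S hgood hN hrank hsha hQ hQS hQ4 hq₀
      hiso8 hisoS hadm hε hp₀S hp8 hsplitp hn₁0 hn₂0 hn₁div hn₂div (Or.inl rfl) (Or.inl rfl) (Finset.empty_subset Q)
      (Finset.empty_subset Q) (by simp) (by simp) hA0 hB0 hloc_n
    -- `[m_a] = [t₁ w₁]`, `[m_b] = [t₂ w₂]`
    have hma_cls : (QuotientGroup.mk (Units.mk0 (ma : ℚ) hma0) : SqUnits ℚ) = QuotientGroup.mk (t₁ * w₁) :=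
      mk_eq_mul_of_mk_mul_eq (by rw [hn₁mk, hm₁])
    have hmb_cls : (QuotientGroup.mk (Units.mk0 (mb : ℚ) hmb0) : SqUnits ℚ) = QuotientGroup.mk (t₂ * w₂) :=
      mk_eq_mul_of_mk_mul_eq (by rw [hn₂mk, hm₂])
    obtain ⟨τ₁, τ₂, hτv, hτQ, hτp1, hτp2, hτs1, hτs2⟩ := hτdata t₁ t₂ htv
    have hc₁v : c₁ = τ₁ + ε * τ₂ := by
      rw [hc₁, ← Units.val_mk0 hma0, qrBit_eq_of_mk_eq q₀ hma_cls, Units.val_mul, qrBit_mul q₀ t₁.ne_zero w₁.ne_zero,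
        (hτQ q₀ hq₀ hq₀F.out).1, (hwres q₀ hq₀ hq₀F.out).1, add_zero]
    have hc₂v : c₂ = (1 + ε) * τ₁ + τ₂ := by
      rw [hc₂, ← Units.val_mk0 hmb0, qrBit_eq_of_mk_eq q₀ hmb_cls, Units.val_mul, qrBit_mul q₀ t₂.ne_zero w₂.ne_zero,
        (hτQ q₀ hq₀ hq₀F.out).2, (hwres q₀ hq₀ hq₀F.out).2, add_zero]
    have hsb : signBit (mb : ℚ) = τ₁ + τ₂ := by
      rw [← Units.val_mk0 hmb0, signBit_eq_of_mk_eq hmb_cls, Units.val_mul, signBit_mul t₂.ne_zero w₂.ne_zero, hτs2, hws.2,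
        add_zero]
    rw [hsb] at hPbI hinf
    refine ⟨1, τ₁, τ₂, γa, γb, Qa, Qb, t₁, t₂, hQaQ, hQbQ, hτv, ⟨hpa0, hpb0, Xa, Xb, hXaval, hXbval, ?_, ?_⟩,
      fun j hj => ?_, hPaI, hPbI, hinf⟩
    · rw [if_pos rfl, hcla, hKa, QuotientGroup.mk_mul, hma_cls, ← QuotientGroup.mk_mul]
      congr 1; ac_rfl
    · rw [if_pos rfl, hclb, hKb, QuotientGroup.mk_mul, hmb_cls, ← QuotientGroup.mk_mul]
      congr 1; ac_rfl
    · obtain ⟨r1, r2⟩ := hrowsI j hj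
      rw [hc₁v] at r1
      rw [hc₂v] at r2
      exact ⟨r1, r2⟩

end Summit.BirchSwinnertonDyer.BirchSwinnertonDyer.Theorems.GenusKolyvaginAtTwo.TorsionCellSEL

end
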